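import Literature.Probability.LatticeModels.TorusFoldable
import Literature.Probability.LatticeModels.TorusTwoPointLimit
import Literature.Probability.LatticeModels.CriticalTwoPointDCPLowerTorus
import Literature.Probability.LatticeModels.CriticalTwoPointDCPLowerLemma25
import Literature.Probability.LatticeModels.AizenmanGrahamInequalityProofs
import HarnessLib

/-!
# Line `free-box-deficit` (crux `ExistsContinuousLimit`, stmt-CriticalPhenomena-4582): stub `stub_torusMaster`

Lead c5 (`prover-line-stmt-CriticalPhenomena-4582-c5-0`), registered skeleton
`Cruxes/ExistsContinuousLimit/Lines/free_box_deficit.lean`. This file proves the ASSEMBLY of the finite-volume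
master inequality on the even torus `𝕋 = (ℤ/Lℤ)³` for a lattice coordinate box `T = Π_i [l_i, u_i] ⊆ Λ_{M−1}`
(`4M + 2 ≤ L`) and `x, y ∈ T`:
`⟨σ_x̄σ_ȳ⟩_𝕋 ≤ ⟨σₓσ_y⟩^free_T + Σ_{six faces F} ⟨σ_x̄ σ_{θ_F ȳ}⟩_𝕋`,
from the two expanded hypotheses CONFINEMENT (`Z^{xy}_𝕋[C_n(y) ⊆ T̄] · Z^∅_{T̄} ≤ Z^{xy}_{T̄} · Z^∅_𝕋`) and
FOLD-UNION (`Z^{xy}_𝕋 ≤ Z^{xy}_𝕋[C_n(y) ⊆ T̄] + Σ_j Z_𝕋({x̄} ∆ {θ_j ȳ})` for six fold data whose strict halves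
contain `T̄` and whose mirrors catch every exit edge of `T̄`).

Steps: (1) the six fold data `θ_{(i,b)} = reflectThroughSites i (c_{(i,b)})`, `c_{(i,true)} = u_i + 1`,
`c_{(i,false)} = l_i − 1`, halves `Torus.leftSites` / `Torus.rightSites` (`Torus.isFoldable_leftSites/rightSites`);
(2) `T̄ ⊆ H_j` (`Torus.proj_mem_leftSites_iff` / `proj_mem_rightSites_iff`); (3) every torus edge leaving `T̄` ends on
a vertex fixed by some `θ_j` (`torusGraph_adj_proj_left_iff`, `zdGraph_adj_iff`, `Torus.reflect_proj_eq_self_iff`);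
(4) fold-union, confinement, `Z_{T̄}({x̄}∆{ȳ}) = ⟨σ_x̄σ_ȳ⟩^free_{T̄} Z_{T̄}(∅)`, division by `Z_𝕋(∅)`, and transport of
the free `T̄`-term back to `ℤ³` (`Torus.isingTwoPoint_free_eq_torus`). No criticality is used (`β ≥ 0`).

References: H. Duminil-Copin, R. Panis, CMP 406 (2025), arXiv:2404.05700, §2.2 (fold data, reflected currents);
S. Friedli, Y. Velenik, CUP 2017, §3.1 (free boundary condition, transport).
-/

noncomputable section

namespace Summit.CriticalPhenomena.Ising3DConformalLimit.ReflectionTwinExistsContinuousLimit.FreeBox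

open Finset Filter
open scoped BigOperators symmDiff ENNReal Topology
open Literature.Probability.LatticeModels
open Classical

/-! ## Real-number bookkeeping -/

/-- **Abstract bookkeeping of the master inequality.** From `Z^{xy} ≤ Z_c + ∑_j Z_j` (fold-union),
`Z_c · Z_T(∅) ≤ Z_T(xy) · Z(∅)` (confinement) and `Z_T(xy) = F · Z_T(∅)` with `Z_T(∅) ∈ (0, ∞)`,
`Z(∅) ∈ (0, ∞)`: `Z^{xy}/Z(∅) ≤ F + ∑_j Z_j / Z(∅)`. [folklore] -/
theorem toReal_div_le_of_foldUnion_of_confinement {ι : Type*} [Fintype ι]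
    {Zxy Zc ZT0 ZTxy Z0 : ℝ≥0∞} {F : ℝ} {Zj : ι → ℝ≥0∞}
    (hUle : Zxy ≤ Zc + ∑ j, Zj j) (hCle : Zc * ZT0 ≤ ZTxy * Z0) (hpair : ZTxy = ENNReal.ofReal F * ZT0)
    (hF : 0 ≤ F) (hZT0 : ZT0 ≠ 0) (hZT0' : ZT0 ≠ ∞) (hZ0 : Z0 ≠ 0) (hZ0' : Z0 ≠ ∞) (hZj : ∀ j, Zj j ≠ ∞) :
    Zxy.toReal / Z0.toReal ≤ F + ∑ j, (Zj j).toReal / Z0.toReal := by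
  -- cancel `Z_T(∅)`
  have hc : Zc ≤ ENNReal.ofReal F * Z0 := by
    rw [hpair, mul_assoc, mul_comm ZT0 Z0, ← mul_assoc] at hCle
    exact (ENNReal.mul_le_mul_iff_left hZT0 hZT0').1 hCle
  have h1 : Zxy ≤ ENNReal.ofReal F * Z0 + ∑ j, Zj j := hUle.trans (add_le_add hc le_rfl)
  have hsum : ∑ j, Zj j ≠ ∞ := ENNReal.sum_ne_top.2 fun j _ => hZj j
  have hmul : ENNReal.ofReal F * Z0 ≠ ∞ := ENNReal.mul_ne_top ENNReal.ofReal_ne_top hZ0'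
  have h2 : Zxy.toReal ≤ F * Z0.toReal + ∑ j, (Zj j).toReal := by
    have h := ENNReal.toReal_mono (ENNReal.add_ne_top.2 ⟨hmul, hsum⟩) h1
    rwa [ENNReal.toReal_add hmul hsum, ENNReal.toReal_mul, ENNReal.toReal_ofReal hF,
      ENNReal.toReal_sum (fun j _ => hZj j)] at h
  have hz0 : 0 < Z0.toReal := ENNReal.toReal_pos hZ0 hZ0'
  rw [div_le_iff₀ hz0, add_mul, Finset.sum_mul]
  calc Zxy.toReal ≤ F * Z0.toReal + ∑ j, (Zj j).toReal := h2
    _ = F * Z0.toReal + ∑ j, (Zj j).toReal / Z0.toReal * Z0.toReal := by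
        congr 1
        exact Finset.sum_congr rfl fun j _ => (div_mul_cancel₀ _ hz0.ne').symm

/-! ## Lattice geometry of coordinate boxes -/

/-- **Exit through a face.** If `z` lies in the coordinate box `[l, u]`, `z' ∼ z` in `ℤ³` and `z' ∉ [l, u]`, then
`z'` lies on one of the six hyperplanes `z'_i = u_i + 1`, `z'_i = l_i − 1`. [folklore] -/
theorem exists_face_of_adj_of_not_mem {l u z z' : Site 3} (hz : ∀ i, l i ≤ z i ∧ z i ≤ u i)
    (hzz' : (zdGraph 3).Adj z z') (hz' : ¬ ∀ i, l i ≤ z' i ∧ z' i ≤ u i) :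
    ∃ i, z' i = u i + 1 ∨ z' i = l i - 1 := by
  -- coordinates of the neighbour
  have key : ∃ i, (∀ k, k ≠ i → z' k = z k) ∧ (z' i = z i + 1 ∨ z' i = z i - 1) := by
    obtain ⟨i, h | h⟩ := (zdGraph_adj_iff z z').1 hzz'
    · refine ⟨i, fun k hk => ?_, Or.inl ?_⟩
      · rw [h, Pi.add_apply, Pi.single_eq_of_ne hk, add_zero]
      · rw [h, Pi.add_apply, Pi.single_eq_same]
    · refine ⟨i, fun k hk => ?_, Or.inr ?_⟩
      · have hk' := congrFun h k
        rw [Pi.add_apply, Pi.single_eq_of_ne hk, add_zero] at hk'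
        exact hk'.symm
      · have hi' := congrFun h i
        rw [Pi.add_apply, Pi.single_eq_same] at hi'
        omega
  obtain ⟨i, hne, hi⟩ := key
  refine ⟨i, ?_⟩
  by_contra hcon
  push Not at hcon
  apply hz'
  intro k
  by_cases hk : k = i
  · subst hk
    have := hz k
    omega
  · rw [hne k hk]
    exact hz k

/-! ## The registered stub -/

/-- **Stub 4 — the master inequality on the even torus** (six face mirrors `reflectThroughSites i (uᵢ+1)`,
`reflectThroughSites i (lᵢ−1)` with halves `Torus.leftSites` / `Torus.rightSites`; confinement + fold-union, divided by
`Z^∅_𝕋`, the `T̄`-term transported to `ℤ³` by `Torus.isingTwoPoint_free_eq_torus`): for `β ≥ 0`, `L` even,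
`4M + 2 ≤ L`, a box `[l,u] ⊆ Λ_{M−1}` and `x, y` in it,
`⟨σ_x̄σ_ȳ⟩_𝕋 ≤ ⟨σₓσ_y⟩^free_{[l,u]} + ∑_{faces} ⟨σ_x̄ σ_{θ_F ȳ}⟩_𝕋`. [folklore] -/
theorem stub_torusMaster
    (hC : ∀ (L : ℕ) [NeZero L] (β : ℝ), 0 ≤ β → ∀ (T : Finset (TorusSite 3 L)) (x y : TorusSite 3 L), x ∈ T → y ∈ T →
    (∑' n : edgesIn (torusGraph 3 L) univ → ℕ,
        ind (csources (torusGraph 3 L) univ n = {x} ∆ {y} ∧ CSupp (torusGraph 3 L) univ (edgesIn (torusGraph 3 L) univ) n ∧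
              ∀ v, CConn (torusGraph 3 L) univ n (edgesIn (torusGraph 3 L) univ) y v → v ∈ T) *
          cweight (torusGraph 3 L) univ β n) *
      currentZ (torusGraph 3 L) univ β (edgesIn (torusGraph 3 L) T) ∅ ≤
    currentZ (torusGraph 3 L) univ β (edgesIn (torusGraph 3 L) T) ({x} ∆ {y}) *
      currentZ (torusGraph 3 L) univ β (edgesIn (torusGraph 3 L) univ) ∅)
    (hU : ∀ (L : ℕ) [NeZero L] (β : ℝ), 0 ≤ β →
    ∀ (θ : Fin 3 × Bool → TorusSite 3 L ≃ TorusSite 3 L) (H : Fin 3 × Bool → Finset (TorusSite 3 L)),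
      (∀ j, IsFoldable (torusGraph 3 L) (θ j) univ (H j)) →
    ∀ (T : Finset (TorusSite 3 L)), (∀ j, T ⊆ H j) →
      (∀ v w, v ∈ T → w ∉ T → (torusGraph 3 L).Adj v w → ∃ j, θ j w = w) →
    ∀ (x y : TorusSite 3 L), x ∈ T → y ∈ T →
      currentZ (torusGraph 3 L) univ β (edgesIn (torusGraph 3 L) univ) ({x} ∆ {y}) ≤
        (∑' n : edgesIn (torusGraph 3 L) univ → ℕ,
          ind (csources (torusGraph 3 L) univ n = {x} ∆ {y} ∧ CSupp (torusGraph 3 L) univ (edgesIn (torusGraph 3 L) univ) n ∧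
                ∀ v, CConn (torusGraph 3 L) univ n (edgesIn (torusGraph 3 L) univ) y v → v ∈ T) *
            cweight (torusGraph 3 L) univ β n) +
        ∑ j, currentZ (torusGraph 3 L) univ β (edgesIn (torusGraph 3 L) univ) ({x} ∆ {θ j y})) :
    ∀ (β : ℝ), 0 ≤ β → ∀ (L : ℕ) [NeZero L], Even L → ∀ (M : ℕ), 4 * M + 2 ≤ L →
    ∀ (l u x y : Site 3), (∀ i, -(M : ℤ) + 1 ≤ l i) → (∀ i, u i ≤ (M : ℤ) - 1) →
      (∀ i, l i ≤ x i ∧ x i ≤ u i) → (∀ i, l i ≤ y i ∧ y i ≤ u i) →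
    isingTorusTwoPoint 3 L β 0 (Torus.proj L x) (Torus.proj L y) ≤
      isingTwoPoint (zdGraph 3) (Fintype.piFinset fun i => Finset.Icc (l i) (u i)) β 0 .free x y +
        ∑ i : Fin 3, (isingTorusTwoPoint 3 L β 0 (Torus.proj L x) (Torus.reflectThroughSites i (((u i + 1 : ℤ)) : ZMod L) (Torus.proj L y)) +
          isingTorusTwoPoint 3 L β 0 (Torus.proj L x) (Torus.reflectThroughSites i (((l i - 1 : ℤ)) : ZMod L) (Torus.proj L y))) := by
  intro β hβ L _ hL M hML l u x y hl hu hx hy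
  -- `M ≥ 1` (the box is nonempty), hence `2 < L` and `2M + 1 < L`
  have hM : 1 ≤ M := by
    have h1 := hl 0; have h2 := hu 0; have h3 := hx 0
    omega
  have h2L : 2 < L := by omega
  have h2M : 2 * M + 1 < L := by omega
  -- the box and its image in the torus
  set T : Finset (Site 3) := Fintype.piFinset fun i => Finset.Icc (l i) (u i) with hT
  have hTmem : ∀ z, z ∈ T ↔ ∀ i, l i ≤ z i ∧ z i ≤ u i := fun z => by
    simp only [hT, Fintype.mem_piFinset, Finset.mem_Icc]
  have hxT : x ∈ T := (hTmem x).2 hx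
  have hyT : y ∈ T := (hTmem y).2 hy
  have hTbox : T ⊆ box 3 M := fun z hz => by
    rw [mem_box]
    intro i
    have h1 := (hTmem z).1 hz i; have h2 := hl i; have h3 := hu i
    omega
  have hTboxp : ∀ z ∈ T, z ∈ box 3 (M - 1) := fun z hz => by
    rw [mem_box]
    intro i
    have h1 := (hTmem z).1 hz i; have h2 := hl i; have h3 := hu i
    omega
  have hxb : Torus.proj L x ∈ T.image (Torus.proj L) := mem_image_of_mem _ hxT
  have hyb : Torus.proj L y ∈ T.image (Torus.proj L) := mem_image_of_mem _ hyT
  -- Step 1: the six fold data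
  obtain ⟨lev, hlev⟩ : ∃ lev : Fin 3 × Bool → ℤ, lev = fun j => if j.2 then u j.1 + 1 else l j.1 - 1 := ⟨_, rfl⟩
  obtain ⟨θ, hθ⟩ : ∃ θ : Fin 3 × Bool → TorusSite 3 L ≃ TorusSite 3 L,
      θ = fun j => Torus.reflectThroughSites j.1 (((lev j : ℤ)) : ZMod L) := ⟨_, rfl⟩
  obtain ⟨H, hH⟩ : ∃ H : Fin 3 × Bool → Finset (TorusSite 3 L),
      H = fun j => if j.2 then Torus.leftSites j.1 (((lev j : ℤ)) : ZMod L)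
        else Torus.rightSites j.1 (((lev j : ℤ)) : ZMod L) := ⟨_, rfl⟩
  have hlevT : ∀ i, lev (i, true) = u i + 1 := fun i => by rw [hlev]; simp
  have hlevF : ∀ i, lev (i, false) = l i - 1 := fun i => by rw [hlev]; simp
  have hlevM : ∀ j, |lev j| ≤ M := by
    rintro ⟨i, b⟩
    have h1 := hl i; have h2 := hu i; have h3 := hx i
    rw [abs_le]
    cases b
    · rw [hlevF]; omega
    · rw [hlevT]; omega
  have hfold : ∀ j, IsFoldable (torusGraph 3 L) (θ j) univ (H j) := by
    rintro ⟨i, b⟩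
    rw [hθ, hH]
    cases b
    · simpa only [Bool.false_eq_true, if_false] using
        Torus.isFoldable_rightSites (d := 3) hL h2L i (((lev (i, false) : ℤ)) : ZMod L)
    · simpa only [if_true] using
        Torus.isFoldable_leftSites (d := 3) hL h2L i (((lev (i, true) : ℤ)) : ZMod L)
  -- Step 2: the image of the box lies in every strict half
  have hTH : ∀ j, T.image (Torus.proj L) ⊆ H j := by
    rintro ⟨i, b⟩ w hw
    obtain ⟨z, hz, rfl⟩ := mem_image.1 hw
    have hzi := (hTmem z).1 hz i
    rw [hH]
    cases b
    · simp only [Bool.false_eq_true, if_false]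
      rw [Torus.proj_mem_rightSites_iff hL i (hlevM (i, false)) hML (hTbox hz), hlevF]
      omega
    · simp only [if_true]
      rw [Torus.proj_mem_leftSites_iff hL i (hlevM (i, true)) hML (hTbox hz), hlevT]
      omega
  -- Step 3: every edge leaving the image of the box ends on a mirror
  have hexit : ∀ v w, v ∈ T.image (Torus.proj L) → w ∉ T.image (Torus.proj L) →
      (torusGraph 3 L).Adj v w → ∃ j, θ j w = w := by
    intro v w hv hw hvw
    obtain ⟨z, hz, rfl⟩ := mem_image.1 hv
    obtain ⟨-, z', rfl, hzz'⟩ := (torusGraph_adj_proj_left_iff L z w).1 hvw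
    have hz'T : ¬ ∀ i, l i ≤ z' i ∧ z' i ≤ u i := fun h => hw (mem_image_of_mem _ ((hTmem z').2 h))
    have hz'box : z' ∈ box 3 M := DCPLower.mem_box_of_adj_of_mem_box_pred hM (hTboxp z hz) hzz'
    obtain ⟨i, hi | hi⟩ := exists_face_of_adj_of_not_mem ((hTmem z).1 hz) hzz' hz'T
    · refine ⟨(i, true), ?_⟩
      rw [hθ]
      simp only
      rw [Torus.reflect_proj_eq_self_iff hL i (hlevM (i, true)) hML hz'box, hlevT]
      exact hi
    · refine ⟨(i, false), ?_⟩
      rw [hθ]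
      simp only
      rw [Torus.reflect_proj_eq_self_iff hL i (hlevM (i, false)) hML hz'box, hlevF]
      exact hi
  -- Step 4: fold-union, confinement, division by `Z(∅)`
  have key := toReal_div_le_of_foldUnion_of_confinement
    (hU L β hβ θ H hfold (T.image (Torus.proj L)) hTH hexit (Torus.proj L x) (Torus.proj L y) hxb hyb)
    (hC L β hβ (T.image (Torus.proj L)) (Torus.proj L x) (Torus.proj L y) hxb hyb)
    (IsFoldable.currentZ_edgesIn_pair_eq hβ (subset_univ _) hxb hyb)
    (DCPLower.isingTwoPoint_free_nonneg_of_mem _ hβ hxb hyb)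
    (currentZ_edgesIn_empty_ne_zero hβ (subset_univ _))
    (currentZ_edgesIn_ne_top hβ (subset_univ _) _)
    (currentZ_edgesIn_empty_ne_zero hβ subset_rfl)
    (currentZ_edgesIn_ne_top hβ subset_rfl _)
    (fun j => currentZ_edgesIn_ne_top hβ subset_rfl _)
  simp only [← DCPLower.isingTwoPoint_univ_eq_currentZ_div (torusGraph 3 L) hβ] at key
  rw [← Torus.isingTwoPoint_free_eq_torus h2M hTbox β hxT hyT, Fintype.sum_prod_type] at key
  simp only [Fintype.sum_bool, hθ, hlevT, hlevF] at key
  unfold isingTorusTwoPoint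
  exact key

end Summit.CriticalPhenomena.Ising3DConformalLimit.ReflectionTwinExistsContinuousLimit.FreeBox

end
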